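import Literature.NumberTheory.Automorphic.UnitaryGroupUnipotentTermCM
import Literature.NumberTheory.Automorphic.UnitaryGroupTruncatedTraceClassKeyedSocketGlue
import HarnessLib

/-!
# The central socket of the trace formula for the quasi-split `U(J₃)` of a CM field, CLOSED on a finite set of classes:
# `Σ_{i ∈ S, i central} p_i(0) = Σ_i (μ(X)·f(z_i) + c_μ·(Cc(z_i) + B(z_i)))`
(Rogawski, *Automorphic Representations of Unitary Groups in Three Variables* (1990), Prop. 7.3.2 (pp. 96–97): the unipotent
term `J^T_G(𝒪_st, f)`, `𝒪 = 𝒪(γ)` with `γ` central, is the sum of the terms (a)–(e); Arthur, *The trace formula in invariant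
form*, Ann. of Math. 114 (1981), Prop. 2.3: `J^T_𝔬(f)` is a polynomial in `log T` and `J_𝔬(f)` its constant term.)

Topic `NumberTheory/Automorphic`; namespace `Literature.NumberTheory.Automorphic.UnitaryGroup`. THEOREMS ONLY over accepted tree
modules (no definition, no named fact, no instance, no notation, no `sorry`). Item (σ-i) «FINSET CLOSER OF THE CENTRAL SOCKET» of
the T1-qs LAW 5 road of `Cruxes/H413/Lines/F0_T1InnerFormTraceIdentity.lean` (cell `pub/hodgecm-mathlib`, crux H413). The socket ★
`arthurTrace_eq_sum_orbital_add_sum_central_add_sum_singular_add_sum_hyperbolic_cm` (`UnitaryGroupArthurTraceThreeSockets`) writes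
`J(f)` with a sum `Σ_{i ∈ S♭_f.filter central} p_i(0)` over the refined classes `i = (((X − z)³) ⊗ 𝔸_L, true)`, `z ∈ L¹`, of the
LAW-3 closer's live set, `p_i` the class polynomial (`J^T_i(f) = p_i(log T)`, `T ≫ 0`). The per-class head ★
`truncatedTraceClass_central_eq_linear_cm` (`UnitaryGroupUnipotentTermCM`, B-p17) computes, for EACH `z ∈ L¹` (key
`ζ : ratOne`, representative `z₁ = ι(z·1)`), constants `C₀, C₁ > 0`, `C₂ ∈ (0, ∞)` and a threshold with
`J^T_i(f) = c_μ·A·log T + (μ(X)·f(z₁) + c_μ·(Cc + B))` — Prop. 7.3.2 (a)–(e) spelled. This file is the bookkeeping that closes the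
SOCKET: by ★ KEYED GLUE `exists_rep_const_sum_classPolynomial_eval_zero_eq` (`UnitaryGroupTruncatedTraceClassKeyedSocketGlue`) at
the key type `↥(ratOne L⁺ L c)`, the normal form `φ ζ = (((X − ζ)³) ⊗ 𝔸_L, true)`, the fibre letter ★
`borelRefine_charpoly_eq_central_iff` and the invariance letters ★ `isConjInvariant_borelRefine` ∕ ★
`isUnipotentInvariantOnBorel_borelRefine` of the refined class map `cl♭`.

* §1 **`exists_ratOne_of_mem_filter_central`** (generic quadratic `(F, E, c)`): a class of the central filter has a key
  `ζ ∈ E¹` with `i = (((X − ζ)³) ⊗ 𝔸_E, true)`.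
* §2 **`exists_rep_sum_filter_central_classPolynomial_eval_zero_cm`** (the CM pin `(L⁺, L, complexConj)`): for a finite set `S`
  of refined indices with class polynomials `P` (`hP`, the socket's letter VERBATIM over all of `S`) there are keys
  `zrep : _ → ↥(ratOne L⁺ L c)` and constants `cst = (C₀, C₁, C₂) : _ → ℝ≥0 × ℝ × ℝ≥0∞` on the central filter with
  `(((X − zrep i)³) ⊗ 𝔸_L, true) = i`, `0 < C₀`, `0 < C₁`, `C₂ ≠ 0, ⊤`, the class polynomials `P i = C (c_μ·A_i) * X + C B_i`, and
  **`Σ_{S.filter central} (P i).eval 0 = Σ_{S.filter central} (μ(X)·f(z₁(zrep i)) + c_μ·(Cc_i + B_i))`** — every letter of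
  ★ `truncatedTraceClass_central_eq_linear_cm` at `ζ := zrep i`, `z₁ := ι(ratCenter (zrep i))`, `(C₀, C₁, C₂) := cst i`.
  This is the hypothesis `closerC` of ★-pending `arthurTrace_eq_orbital_add_central_add_singular_add_hyperbolic_of_closers`
  (`UnitaryGroupArthurTraceThreeSocketsClosed`, p05) at `κc := ↥(ratOne L⁺ L c) × (ℝ≥0 × ℝ × ℝ≥0∞)`.
* §3 (ED. 2) **`exists_keyrep_sum_filter_central_classPolynomial_eval_zero_cm`** — §2 with key and constants PAIRED: literally the
  `closerC` hypothesis of that skeleton at `κc := ratOne L⁺ L c × (ℝ≥0 × ℝ × ℝ≥0∞)`, `Bc p :=` the constant term at `p.1`, `p.2`.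

## References

* J. D. Rogawski, *Automorphic Representations of Unitary Groups in Three Variables*, Annals of Mathematics Studies 123 (1990),
  Prop. 7.3.2 (pp. 96–97), §2.2–2.3 (pp. 13–14), Prop. 3.9.1 (p. 32) [Rogawski1990].
* J. Arthur, *The trace formula in invariant form*, Ann. of Math. 114 (1981), Prop. 2.3 [Arthur1981TraceFormulaInvariantForm].
-/

set_option autoImplicit false

noncomputable section

open MeasureTheory MeasureTheory.Measure NumberField IsDedekindDomain Set Filter Polynomial Function Literature.MeasureTheory.Group
open scoped ENNReal NNReal MatrixGroups Classical
open Literature.NumberTheory.Automorphic.Meyer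
open Literature.NumberTheory.QuadraticForms (normIdeles)

namespace Literature.NumberTheory.Automorphic

namespace UnitaryGroup

/-! ## §1 Keys of the central classes -/

section Key

variable {F E : Type} [Field F] [NumberField F] [Field E] [NumberField E] [Algebra F E] {c : E ≃ₐ[F] E}

omit [NumberField F] in
/-- **EVERY CLASS OF THE CENTRAL SOCKET HAS A KEY IN `E¹`.** If the refined index `i = (p, flag)` lies in the central filter of
★ `arthurTrace_eq_sum_orbital_add_sum_central_add_sum_singular_add_sum_hyperbolic_cm` (`flag = true`, `p = (X − z)³ ⊗ 𝔸_E` with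
`c z · z = 1`), then `z = ζ ∈ E¹ = ratOne F E c` and `i = (((X − ζ)³) ⊗ 𝔸_E, true)` — the `hpq` letter of ★ KEYED GLUE.
[cite: Rogawski1990, §2.2 (p. 13)] [cite: Rogawski1990, Prop. 3.9.1 (p. 32)] -/
theorem exists_ratOne_of_mem_filter_central (S : Finset ((AdeleRing (𝓞 E) E)[X] × Bool))
    (i : (AdeleRing (𝓞 E) E)[X] × Bool) (_hi : i ∈ S)
    (hpi : (fun i : (AdeleRing (𝓞 E) E)[X] × Bool => i.2 = true ∧
        ∃ z : Eˣ, c (z : E) * (z : E) = 1 ∧ i.1 = ((X - C (z : E)) ^ 3).map (algebraMap E (AdeleRing (𝓞 E) E))) i) :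
    ∃ ζ : ratOne F E c, True ∧
      ((((X - C (((ζ : Eˣ) : E))) ^ 3).map (algebraMap E (AdeleRing (𝓞 E) E))), true) = i := by
  obtain ⟨hi2, z, hz, hi1⟩ := hpi
  refine ⟨⟨z, (mem_ratOne_iff F E c z).2 (by rw [RingHom.coe_coe]; exact hz)⟩, trivial, ?_⟩
  exact Prod.ext hi1.symm hi2.symm

/-- Packaging three nested existential constants `∃ a, p a ∧ ∃ b, q b ∧ ∃ c, r c ∧ r' c ∧ Q a b c` as ONE triple
`e = (a, b, c)`: `∃ e, (p e.1 ∧ q e.2.1 ∧ r e.2.2 ∧ r' e.2.2) ∧ Q e.1 e.2.1 e.2.2` — the shape ★ KEYED GLUE's `_const` lemma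
consumes (constants behind the key). [folklore] -/
private theorem exists_prod₃_of_exists₃ {α β γ : Type*} {p : α → Prop} {q : β → Prop} {r r' : γ → Prop}
    {Q : α → β → γ → Prop} (h : ∃ a, p a ∧ ∃ b, q b ∧ ∃ c, r c ∧ r' c ∧ Q a b c) :
    ∃ e : α × β × γ, (p e.1 ∧ q e.2.1 ∧ r e.2.2 ∧ r' e.2.2) ∧ Q e.1 e.2.1 e.2.2 := by
  obtain ⟨a, ha, b, hb, c, hc, hc', hQ⟩ := h
  exact ⟨(a, b, c), ⟨ha, hb, hc, hc'⟩, hQ⟩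

end Key

/-! ## §2 The central socket closed at the CM pin -/

section CM

/-- **THE CENTRAL SOCKET, CLOSED ON A FINITE SET OF CLASSES (CM pin)** [Rogawski1990, Prop. 7.3.2 (pp. 96–97)]. At the CM pair
`(L⁺, L, complexConj)`, for a test function `f`, an automorphic measure `μ`, the Haar ∕ quadratic data of ★
`truncatedTraceClass_central_eq_linear_cm`, a finite set `S` of refined indices and class polynomials `P` with
`J^T_i(f) = P_i(log T)` for `T ≫ 0` (`i ∈ S`; the socket's letter `hP`): there are keys `zrep i ∈ L¹` and constants
`cst i = (C₀, C₁, C₂)` such that on the central filter `(((X − zrep i)³) ⊗ 𝔸_L, true) = i`, `0 < C₀`, `0 < C₁`, `C₂ ≠ 0`, `C₂ ≠ ⊤`,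
`P i = C (c_μ·A_i) * X + C B_i` and `Σ_{S.filter central} P_i(0) = Σ_{S.filter central} B_i`, with `A_i`, `B_i` the letters of ★
`truncatedTraceClass_central_eq_linear_cm` at `ζ := zrep i`, `z₁ := ι(ratCenter (zrep i))` [(a) `μ(X)·f(z₁)`, (b)+(e) the
Heisenberg road, (c)+(d) the centre-lattice road]. ★ KEYED GLUE `exists_rep_const_sum_classPolynomial_eval_zero_eq` ∘ ★
`truncatedTraceClass_central_eq_linear_cm` ∘ ★ `borelRefine_charpoly_eq_central_iff`.
[cite: Rogawski1990, Prop. 7.3.2 (pp. 96–97)] [cite: Arthur1981TraceFormulaInvariantForm, Prop. 2.3] -/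
theorem exists_rep_sum_filter_central_classPolynomial_eval_zero_cm (L : Type) [Field L] [NumberField L] [IsCMField L]
    [MeasurableSpace (adelicUnipotent (↥(maximalRealSubfield L)) L (IsCMField.complexConj L) 3)]
    [BorelSpace (adelicUnipotent (↥(maximalRealSubfield L)) L (IsCMField.complexConj L) 3)]
    [MeasurableSpace (quasiSplit (↥(maximalRealSubfield L)) L (IsCMField.complexConj L) 3).Adelic]
    [BorelSpace (quasiSplit (↥(maximalRealSubfield L)) L (IsCMField.complexConj L) 3).Adelic]
    [MeasurableSpace (AdeleRing (𝓞 L) L)] [BorelSpace (AdeleRing (𝓞 L) L)]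
    [MeasurableSpace (GaloisRepresentations.ideleGroup L)] [BorelSpace (GaloisRepresentations.ideleGroup L)]
    [MeasurableSpace (AdeleRing (𝓞 (↥(maximalRealSubfield L))) (↥(maximalRealSubfield L)))ˣ]
    [BorelSpace (AdeleRing (𝓞 (↥(maximalRealSubfield L))) (↥(maximalRealSubfield L)))ˣ]
    (ν : Measure (adelicUnipotent (↥(maximalRealSubfield L)) L (IsCMField.complexConj L) 3)) [ν.IsHaarMeasure]
    {𝓕 : Set (adelicUnipotent (↥(maximalRealSubfield L)) L (IsCMField.complexConj L) 3)} (h𝓕 : IsFundamentalDomain (rationalUnipotent (↥(maximalRealSubfield L)) L (IsCMField.complexConj L) 3) 𝓕 ν)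
    {f : (quasiSplit (↥(maximalRealSubfield L)) L (IsCMField.complexConj L) 3).Adelic → ℂ} (hf : IsQuasiSplitTest (↥(maximalRealSubfield L)) L (IsCMField.complexConj L) 3 f)
    (μ : Measure (quasiSplit (↥(maximalRealSubfield L)) L (IsCMField.complexConj L) 3).automorphicQuotient) [(quasiSplit (↥(maximalRealSubfield L)) L (IsCMField.complexConj L) 3).IsAutomorphicMeasure μ]
    (νG : Measure (quasiSplit (↥(maximalRealSubfield L)) L (IsCMField.complexConj L) 3).Adelic) [νG.IsHaarMeasure]
    {β : (quasiSplit (↥(maximalRealSubfield L)) L (IsCMField.complexConj L) 3).Adelic → ℝ≥0∞}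
    (hβ : IsCoveringWeight ((arithmeticBorel (↥(maximalRealSubfield L)) L (IsCMField.complexConj L) 3).map (quasiSplit (↥(maximalRealSubfield L)) L (IsCMField.complexConj L) 3).arithmeticSubgroup.subtype) β)
    (μB : Measure (borelAdelic (↥(maximalRealSubfield L)) L (IsCMField.complexConj L) 3)) [μB.IsHaarMeasure]
    (μK : Measure ((standardMaximalCompactGL 3 L).comap
      (adelicVal (↥(maximalRealSubfield L)) L (IsCMField.complexConj L) 3 ((StdForm.antidiagonal 3).over L)) : Subgroup (quasiSplit (↥(maximalRealSubfield L)) L (IsCMField.complexConj L) 3).Adelic))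
    [μK.IsHaarMeasure]
    (μT : Measure (torusInBorel (↥(maximalRealSubfield L)) L (IsCMField.complexConj L) 3)) [μT.IsHaarMeasure]
    (μX : Measure (AdeleRing (𝓞 L) L)) [μX.IsAddHaarMeasure]
    (μY : Measure (traceZeroAdele (↥(maximalRealSubfield L)) L (IsCMField.complexConj L))) [μY.IsAddHaarMeasure]
    {wT : torusInBorel (↥(maximalRealSubfield L)) L (IsCMField.complexConj L) 3 → ℝ≥0∞}
    (hwT : IsCoveringWeight ((((quasiSplit (↥(maximalRealSubfield L)) L (IsCMField.complexConj L) 3).arithmeticSubgroup).subgroupOf (borelAdelic (↥(maximalRealSubfield L)) L (IsCMField.complexConj L) 3)).subgroupOf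
      (torusInBorel (↥(maximalRealSubfield L)) L (IsCMField.complexConj L) 3)) wT)
    {δ : L} (hcδ : (IsCMField.complexConj L) δ = -δ) (hδ : δ ≠ 0) (θ : 𝓞 (↥(maximalRealSubfield L))) (hθ : θ ≠ 0)
    (hd : δ * δ = algebraMap (↥(maximalRealSubfield L)) L (θ : (↥(maximalRealSubfield L))))
    (μF : Measure (AdeleRing (𝓞 (↥(maximalRealSubfield L))) (↥(maximalRealSubfield L)))ˣ) [IsHaarMeasure μF]
    (νI : Measure (GaloisRepresentations.ideleGroup L)) [νI.IsHaarMeasure]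
    {𝓕E : Set (GaloisRepresentations.ideleGroup L)} (h𝓕E : IsIdeleClassDomain L 𝓕E)
    (S : Finset ((AdeleRing (𝓞 L) L)[X] × Bool)) (P : (AdeleRing (𝓞 L) L)[X] × Bool → ℂ[X])
    (hP : ∀ i ∈ S, ∃ T₀ : ℝ≥0, ∀ T : ℝ≥0, T₀ < T →
      truncatedTraceClass μ ν 𝓕 T
          (fun γ : (quasiSplit (↥(maximalRealSubfield L)) L (IsCMField.complexConj L) 3).arithmeticSubgroup =>
            (((adelicVal (↥(maximalRealSubfield L)) L (IsCMField.complexConj L) 3 _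
                (γ : (quasiSplit (↥(maximalRealSubfield L)) L (IsCMField.complexConj L) 3).Adelic) :
                GL (Fin 3) (AdeleRing (𝓞 L) L)) : Matrix (Fin 3) (Fin 3) (AdeleRing (𝓞 L) L)).charpoly,
              decide (∃ δ : (quasiSplit (↥(maximalRealSubfield L)) L (IsCMField.complexConj L) 3).arithmeticSubgroup,
                δ * γ * δ⁻¹ ∈ arithmeticBorel (↥(maximalRealSubfield L)) L (IsCMField.complexConj L) 3)))
          i f = (P i).eval ((Real.log (T : ℝ) : ℝ) : ℂ)) :
    haveI := t2Space_adeleRing_of_numberField L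
    haveI := locallyCompactSpace_adeleRing' L
    haveI := secondCountableTopology_adeleRing L
    haveI : T2Space (quasiSplit (↥(maximalRealSubfield L)) L (IsCMField.complexConj L) 3).Adelic :=
      inferInstanceAs (T2Space (adelic (↥(maximalRealSubfield L)) L (IsCMField.complexConj L) 3 ((StdForm.antidiagonal 3).over L)))
    haveI : LocallyCompactSpace (quasiSplit (↥(maximalRealSubfield L)) L (IsCMField.complexConj L) 3).Adelic :=
      inferInstanceAs (LocallyCompactSpace (adelic (↥(maximalRealSubfield L)) L (IsCMField.complexConj L) 3 ((StdForm.antidiagonal 3).over L)))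
    haveI : SecondCountableTopology (quasiSplit (↥(maximalRealSubfield L)) L (IsCMField.complexConj L) 3).Adelic :=
      inferInstanceAs (SecondCountableTopology (adelic (↥(maximalRealSubfield L)) L (IsCMField.complexConj L) 3 ((StdForm.antidiagonal 3).over L)))
    haveI : DiscreteTopology (quasiSplit (↥(maximalRealSubfield L)) L (IsCMField.complexConj L) 3).quotientSubgroup := by
      rw [quotientSubgroup_quasiSplit]; exact isDiscreteRational_quasiSplit
    letI := AdelicGroupData.measurableSpaceQuotientForm (quasiSplit (↥(maximalRealSubfield L)) L (IsCMField.complexConj L) 3)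
    haveI := AdelicGroupData.borelSpaceQuotientForm (quasiSplit (↥(maximalRealSubfield L)) L (IsCMField.complexConj L) 3)
    haveI := AdelicGroupData.smulInvariantMeasureQuotientForm (quasiSplit (↥(maximalRealSubfield L)) L (IsCMField.complexConj L) 3) μ
    haveI := AdelicGroupData.isFiniteMeasureOnCompactsQuotientForm (quasiSplit (↥(maximalRealSubfield L)) L (IsCMField.complexConj L) 3) μ
    ∃ (zrep : (AdeleRing (𝓞 L) L)[X] × Bool → ratOne (↥(maximalRealSubfield L)) L (IsCMField.complexConj L))
      (cst : (AdeleRing (𝓞 L) L)[X] × Bool → ℝ≥0 × ℝ × ℝ≥0∞),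
      (∀ i ∈ S.filter (fun i : (AdeleRing (𝓞 L) L)[X] × Bool => i.2 = true ∧
        ∃ z : Lˣ, (IsCMField.complexConj L) (z : L) * (z : L) = 1 ∧
          i.1 = ((X - C (z : L)) ^ 3).map (algebraMap L (AdeleRing (𝓞 L) L))),
        ((((X - C (((zrep i : Lˣ) : L))) ^ 3).map (algebraMap L (AdeleRing (𝓞 L) L))), true) = i ∧
          (0 < (cst i).1 ∧ 0 < (cst i).2.1 ∧ (cst i).2.2 ≠ 0 ∧ (cst i).2.2 ≠ ⊤)) ∧
      (∀ i ∈ S.filter (fun i : (AdeleRing (𝓞 L) L)[X] × Bool => i.2 = true ∧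
        ∃ z : Lˣ, (IsCMField.complexConj L) (z : L) * (z : L) = 1 ∧
          i.1 = ((X - C (z : L)) ^ 3).map (algebraMap L (AdeleRing (𝓞 L) L))),
        P i = C (
        ((unfoldingConstant (quasiSplit (↥(maximalRealSubfield L)) L (IsCMField.complexConj L) 3).quotientSubgroup
            (count : Measure (quasiSplit (↥(maximalRealSubfield L)) L (IsCMField.complexConj L) 3).quotientSubgroup) μ νG : ℝ) : ℂ) *
          ((((cst i).2.1 : ℝ) : ℂ) * ((μX.real (adeleFundamentalDomain L) : ℂ) * (((cst i).2.2).toReal : ℂ)) *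
            (((idelicCovolume L νI).toReal : ℂ) * (((μX (adeleFundamentalDomain L)).toReal⁻¹ : ℂ) *
              adeleFourier L μX (fun x => ∫ y' : traceZeroAdele (↥(maximalRealSubfield L)) L (IsCMField.complexConj L),
        (∫ k, f ((k : (quasiSplit (↥(maximalRealSubfield L)) L (IsCMField.complexConj L) 3).Adelic)⁻¹ * (((quasiSplit (↥(maximalRealSubfield L)) L (IsCMField.complexConj L) 3).toAdelic (ratCenter (↥(maximalRealSubfield L)) L (IsCMField.complexConj L) 3 ((StdForm.antidiagonal 3).over L) (zrep i))) *
          (((heisChart (complexConj_mul_complexConj L) (x, y')) : adelicUnipotent (↥(maximalRealSubfield L)) L (IsCMField.complexConj L) 3) :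
              (quasiSplit (↥(maximalRealSubfield L)) L (IsCMField.complexConj L) 3).Adelic)) * (k : (quasiSplit (↥(maximalRealSubfield L)) L (IsCMField.complexConj L) 3).Adelic)) ∂μK) ∂μY) 0)))) * X + C (
          ((μ.real Set.univ : ℝ) • f ((quasiSplit (↥(maximalRealSubfield L)) L (IsCMField.complexConj L) 3).toAdelic (ratCenter (↥(maximalRealSubfield L)) L (IsCMField.complexConj L) 3 ((StdForm.antidiagonal 3).over L) (zrep i))) +
            ((unfoldingConstant (quasiSplit (↥(maximalRealSubfield L)) L (IsCMField.complexConj L) 3).quotientSubgroup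
            (count : Measure (quasiSplit (↥(maximalRealSubfield L)) L (IsCMField.complexConj L) 3).quotientSubgroup) μ νG : ℝ) : ℂ) * (((((cst i).1 : ℝ) : ℂ) * ((heisHaar (complexConj_mul_complexConj L) μX μY).real
              (heisHomeomorph (complexConj_mul_complexConj L) '' (adeleFundamentalDomain L ×ˢ traceZeroFundamentalDomain (↥(maximalRealSubfield L)) L (IsCMField.complexConj L))) : ℂ) *
            ∫ y in ↑(GaloisRepresentations.principalIdeles (↥(maximalRealSubfield L)) ⊔ normIdeles (↥(maximalRealSubfield L)) (θ : (↥(maximalRealSubfield L)))),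
              (((IdeleClassGroup.ideleNorm (↥(maximalRealSubfield L)) y ^ 2)⁻¹ : ℝ≥0) : ℝ) •
                ∫ k, f ((k : (quasiSplit (↥(maximalRealSubfield L)) L (IsCMField.complexConj L) 3).Adelic)⁻¹ * (((quasiSplit (↥(maximalRealSubfield L)) L (IsCMField.complexConj L) 3).toAdelic (ratCenter (↥(maximalRealSubfield L)) L (IsCMField.complexConj L) 3 ((StdForm.antidiagonal 3).over L) (zrep i))) *
                  ((heisChart (complexConj_mul_complexConj L) ((0 : AdeleRing (𝓞 L) L),
                      traceZeroLine (↥(maximalRealSubfield L)) L (IsCMField.complexConj L) hcδ hδ (((y⁻¹ : (AdeleRing (𝓞 (↥(maximalRealSubfield L))) (↥(maximalRealSubfield L)))ˣ)) : AdeleRing (𝓞 (↥(maximalRealSubfield L))) (↥(maximalRealSubfield L)))) :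
                    adelicUnipotent (↥(maximalRealSubfield L)) L (IsCMField.complexConj L) 3) : (quasiSplit (↥(maximalRealSubfield L)) L (IsCMField.complexConj L) 3).Adelic)) * (k : (quasiSplit (↥(maximalRealSubfield L)) L (IsCMField.complexConj L) 3).Adelic)) ∂μK
              ∂μF) +
          ((((cst i).2.1 : ℝ) : ℂ) * ((μX.real (adeleFundamentalDomain L) : ℂ) * (((cst i).2.2).toReal : ℂ)) *
            (((∫ x in {x | 1 ≤ (IdeleClassGroup.ideleNorm L x : ℝ)} ∩ 𝓕E,
                  ideleSum L (fun x => ∫ y' : traceZeroAdele (↥(maximalRealSubfield L)) L (IsCMField.complexConj L),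
        (∫ k, f ((k : (quasiSplit (↥(maximalRealSubfield L)) L (IsCMField.complexConj L) 3).Adelic)⁻¹ * (((quasiSplit (↥(maximalRealSubfield L)) L (IsCMField.complexConj L) 3).toAdelic (ratCenter (↥(maximalRealSubfield L)) L (IsCMField.complexConj L) 3 ((StdForm.antidiagonal 3).over L) (zrep i))) *
          (((heisChart (complexConj_mul_complexConj L) (x, y')) : adelicUnipotent (↥(maximalRealSubfield L)) L (IsCMField.complexConj L) 3) :
              (quasiSplit (↥(maximalRealSubfield L)) L (IsCMField.complexConj L) 3).Adelic)) * (k : (quasiSplit (↥(maximalRealSubfield L)) L (IsCMField.complexConj L) 3).Adelic)) ∂μK) ∂μY) x * ((IdeleClassGroup.ideleNorm L x : ℝ) : ℂ) ∂νI) +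
                ((μX (adeleFundamentalDomain L)).toReal⁻¹ : ℂ) *
                  (∫ x in {x | 1 ≤ (IdeleClassGroup.ideleNorm L x : ℝ)} ∩ 𝓕E,
                    ideleSum L (adeleFourier L μX (fun x => ∫ y' : traceZeroAdele (↥(maximalRealSubfield L)) L (IsCMField.complexConj L),
        (∫ k, f ((k : (quasiSplit (↥(maximalRealSubfield L)) L (IsCMField.complexConj L) 3).Adelic)⁻¹ * (((quasiSplit (↥(maximalRealSubfield L)) L (IsCMField.complexConj L) 3).toAdelic (ratCenter (↥(maximalRealSubfield L)) L (IsCMField.complexConj L) 3 ((StdForm.antidiagonal 3).over L) (zrep i))) *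
          (((heisChart (complexConj_mul_complexConj L) (x, y')) : adelicUnipotent (↥(maximalRealSubfield L)) L (IsCMField.complexConj L) 3) :
              (quasiSplit (↥(maximalRealSubfield L)) L (IsCMField.complexConj L) 3).Adelic)) * (k : (quasiSplit (↥(maximalRealSubfield L)) L (IsCMField.complexConj L) 3).Adelic)) ∂μK) ∂μY)) x ∂νI) -
                ((idelicCovolume L νI).toReal : ℂ) * (fun x => ∫ y' : traceZeroAdele (↥(maximalRealSubfield L)) L (IsCMField.complexConj L),
        (∫ k, f ((k : (quasiSplit (↥(maximalRealSubfield L)) L (IsCMField.complexConj L) 3).Adelic)⁻¹ * (((quasiSplit (↥(maximalRealSubfield L)) L (IsCMField.complexConj L) 3).toAdelic (ratCenter (↥(maximalRealSubfield L)) L (IsCMField.complexConj L) 3 ((StdForm.antidiagonal 3).over L) (zrep i))) *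
          (((heisChart (complexConj_mul_complexConj L) (x, y')) : adelicUnipotent (↥(maximalRealSubfield L)) L (IsCMField.complexConj L) 3) :
              (quasiSplit (↥(maximalRealSubfield L)) L (IsCMField.complexConj L) 3).Adelic)) * (k : (quasiSplit (↥(maximalRealSubfield L)) L (IsCMField.complexConj L) 3).Adelic)) ∂μK) ∂μY) 0) -
              (((idelicCovolume L νI).toReal : ℂ) * (((μX (adeleFundamentalDomain L)).toReal⁻¹ : ℂ) *
                  adeleFourier L μX (fun x => ∫ y' : traceZeroAdele (↥(maximalRealSubfield L)) L (IsCMField.complexConj L),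
        (∫ k, f ((k : (quasiSplit (↥(maximalRealSubfield L)) L (IsCMField.complexConj L) 3).Adelic)⁻¹ * (((quasiSplit (↥(maximalRealSubfield L)) L (IsCMField.complexConj L) 3).toAdelic (ratCenter (↥(maximalRealSubfield L)) L (IsCMField.complexConj L) 3 ((StdForm.antidiagonal 3).over L) (zrep i))) *
          (((heisChart (complexConj_mul_complexConj L) (x, y')) : adelicUnipotent (↥(maximalRealSubfield L)) L (IsCMField.complexConj L) 3) :
              (quasiSplit (↥(maximalRealSubfield L)) L (IsCMField.complexConj L) 3).Adelic)) * (k : (quasiSplit (↥(maximalRealSubfield L)) L (IsCMField.complexConj L) 3).Adelic)) ∂μK) ∂μY) 0)) *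
                ((Real.log (borelHeight (1 : (quasiSplit (↥(maximalRealSubfield L)) L (IsCMField.complexConj L) 3).Adelic) : ℝ) : ℝ) : ℂ))))))) ∧
      ∑ i ∈ S.filter (fun i : (AdeleRing (𝓞 L) L)[X] × Bool => i.2 = true ∧
        ∃ z : Lˣ, (IsCMField.complexConj L) (z : L) * (z : L) = 1 ∧
          i.1 = ((X - C (z : L)) ^ 3).map (algebraMap L (AdeleRing (𝓞 L) L))), (P i).eval 0 =
        ∑ i ∈ S.filter (fun i : (AdeleRing (𝓞 L) L)[X] × Bool => i.2 = true ∧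
        ∃ z : Lˣ, (IsCMField.complexConj L) (z : L) * (z : L) = 1 ∧
          i.1 = ((X - C (z : L)) ^ 3).map (algebraMap L (AdeleRing (𝓞 L) L))),
          ((μ.real Set.univ : ℝ) • f ((quasiSplit (↥(maximalRealSubfield L)) L (IsCMField.complexConj L) 3).toAdelic (ratCenter (↥(maximalRealSubfield L)) L (IsCMField.complexConj L) 3 ((StdForm.antidiagonal 3).over L) (zrep i))) +
            ((unfoldingConstant (quasiSplit (↥(maximalRealSubfield L)) L (IsCMField.complexConj L) 3).quotientSubgroup
            (count : Measure (quasiSplit (↥(maximalRealSubfield L)) L (IsCMField.complexConj L) 3).quotientSubgroup) μ νG : ℝ) : ℂ) * (((((cst i).1 : ℝ) : ℂ) * ((heisHaar (complexConj_mul_complexConj L) μX μY).real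
              (heisHomeomorph (complexConj_mul_complexConj L) '' (adeleFundamentalDomain L ×ˢ traceZeroFundamentalDomain (↥(maximalRealSubfield L)) L (IsCMField.complexConj L))) : ℂ) *
            ∫ y in ↑(GaloisRepresentations.principalIdeles (↥(maximalRealSubfield L)) ⊔ normIdeles (↥(maximalRealSubfield L)) (θ : (↥(maximalRealSubfield L)))),
              (((IdeleClassGroup.ideleNorm (↥(maximalRealSubfield L)) y ^ 2)⁻¹ : ℝ≥0) : ℝ) •
                ∫ k, f ((k : (quasiSplit (↥(maximalRealSubfield L)) L (IsCMField.complexConj L) 3).Adelic)⁻¹ * (((quasiSplit (↥(maximalRealSubfield L)) L (IsCMField.complexConj L) 3).toAdelic (ratCenter (↥(maximalRealSubfield L)) L (IsCMField.complexConj L) 3 ((StdForm.antidiagonal 3).over L) (zrep i))) *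
                  ((heisChart (complexConj_mul_complexConj L) ((0 : AdeleRing (𝓞 L) L),
                      traceZeroLine (↥(maximalRealSubfield L)) L (IsCMField.complexConj L) hcδ hδ (((y⁻¹ : (AdeleRing (𝓞 (↥(maximalRealSubfield L))) (↥(maximalRealSubfield L)))ˣ)) : AdeleRing (𝓞 (↥(maximalRealSubfield L))) (↥(maximalRealSubfield L)))) :
                    adelicUnipotent (↥(maximalRealSubfield L)) L (IsCMField.complexConj L) 3) : (quasiSplit (↥(maximalRealSubfield L)) L (IsCMField.complexConj L) 3).Adelic)) * (k : (quasiSplit (↥(maximalRealSubfield L)) L (IsCMField.complexConj L) 3).Adelic)) ∂μK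
              ∂μF) +
          ((((cst i).2.1 : ℝ) : ℂ) * ((μX.real (adeleFundamentalDomain L) : ℂ) * (((cst i).2.2).toReal : ℂ)) *
            (((∫ x in {x | 1 ≤ (IdeleClassGroup.ideleNorm L x : ℝ)} ∩ 𝓕E,
                  ideleSum L (fun x => ∫ y' : traceZeroAdele (↥(maximalRealSubfield L)) L (IsCMField.complexConj L),
        (∫ k, f ((k : (quasiSplit (↥(maximalRealSubfield L)) L (IsCMField.complexConj L) 3).Adelic)⁻¹ * (((quasiSplit (↥(maximalRealSubfield L)) L (IsCMField.complexConj L) 3).toAdelic (ratCenter (↥(maximalRealSubfield L)) L (IsCMField.complexConj L) 3 ((StdForm.antidiagonal 3).over L) (zrep i))) *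
          (((heisChart (complexConj_mul_complexConj L) (x, y')) : adelicUnipotent (↥(maximalRealSubfield L)) L (IsCMField.complexConj L) 3) :
              (quasiSplit (↥(maximalRealSubfield L)) L (IsCMField.complexConj L) 3).Adelic)) * (k : (quasiSplit (↥(maximalRealSubfield L)) L (IsCMField.complexConj L) 3).Adelic)) ∂μK) ∂μY) x * ((IdeleClassGroup.ideleNorm L x : ℝ) : ℂ) ∂νI) +
                ((μX (adeleFundamentalDomain L)).toReal⁻¹ : ℂ) *
                  (∫ x in {x | 1 ≤ (IdeleClassGroup.ideleNorm L x : ℝ)} ∩ 𝓕E,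
                    ideleSum L (adeleFourier L μX (fun x => ∫ y' : traceZeroAdele (↥(maximalRealSubfield L)) L (IsCMField.complexConj L),
        (∫ k, f ((k : (quasiSplit (↥(maximalRealSubfield L)) L (IsCMField.complexConj L) 3).Adelic)⁻¹ * (((quasiSplit (↥(maximalRealSubfield L)) L (IsCMField.complexConj L) 3).toAdelic (ratCenter (↥(maximalRealSubfield L)) L (IsCMField.complexConj L) 3 ((StdForm.antidiagonal 3).over L) (zrep i))) *
          (((heisChart (complexConj_mul_complexConj L) (x, y')) : adelicUnipotent (↥(maximalRealSubfield L)) L (IsCMField.complexConj L) 3) :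
              (quasiSplit (↥(maximalRealSubfield L)) L (IsCMField.complexConj L) 3).Adelic)) * (k : (quasiSplit (↥(maximalRealSubfield L)) L (IsCMField.complexConj L) 3).Adelic)) ∂μK) ∂μY)) x ∂νI) -
                ((idelicCovolume L νI).toReal : ℂ) * (fun x => ∫ y' : traceZeroAdele (↥(maximalRealSubfield L)) L (IsCMField.complexConj L),
        (∫ k, f ((k : (quasiSplit (↥(maximalRealSubfield L)) L (IsCMField.complexConj L) 3).Adelic)⁻¹ * (((quasiSplit (↥(maximalRealSubfield L)) L (IsCMField.complexConj L) 3).toAdelic (ratCenter (↥(maximalRealSubfield L)) L (IsCMField.complexConj L) 3 ((StdForm.antidiagonal 3).over L) (zrep i))) *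
          (((heisChart (complexConj_mul_complexConj L) (x, y')) : adelicUnipotent (↥(maximalRealSubfield L)) L (IsCMField.complexConj L) 3) :
              (quasiSplit (↥(maximalRealSubfield L)) L (IsCMField.complexConj L) 3).Adelic)) * (k : (quasiSplit (↥(maximalRealSubfield L)) L (IsCMField.complexConj L) 3).Adelic)) ∂μK) ∂μY) 0) -
              (((idelicCovolume L νI).toReal : ℂ) * (((μX (adeleFundamentalDomain L)).toReal⁻¹ : ℂ) *
                  adeleFourier L μX (fun x => ∫ y' : traceZeroAdele (↥(maximalRealSubfield L)) L (IsCMField.complexConj L),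
        (∫ k, f ((k : (quasiSplit (↥(maximalRealSubfield L)) L (IsCMField.complexConj L) 3).Adelic)⁻¹ * (((quasiSplit (↥(maximalRealSubfield L)) L (IsCMField.complexConj L) 3).toAdelic (ratCenter (↥(maximalRealSubfield L)) L (IsCMField.complexConj L) 3 ((StdForm.antidiagonal 3).over L) (zrep i))) *
          (((heisChart (complexConj_mul_complexConj L) (x, y')) : adelicUnipotent (↥(maximalRealSubfield L)) L (IsCMField.complexConj L) 3) :
              (quasiSplit (↥(maximalRealSubfield L)) L (IsCMField.complexConj L) 3).Adelic)) * (k : (quasiSplit (↥(maximalRealSubfield L)) L (IsCMField.complexConj L) 3).Adelic)) ∂μK) ∂μY) 0)) *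
                ((Real.log (borelHeight (1 : (quasiSplit (↥(maximalRealSubfield L)) L (IsCMField.complexConj L) 3).Adelic) : ℝ) : ℝ) : ℂ))))) := by
  -- the per-key row closer: ★ `truncatedTraceClass_central_eq_linear_cm` at `z₁ := ι(ratCenter ζ)`, `cl := cl♭`, its three
  -- constants `(C₀, C₁, C₂)` packaged as one `e : ℝ≥0 × ℝ × ℝ≥0∞` (the letters `a`, `b` of ★ KEYED GLUE are read off by unification)
  have hrow := fun (ζ : ratOne (↥(maximalRealSubfield L)) L (IsCMField.complexConj L)) (_ : True) =>
    exists_prod₃_of_exists₃ (truncatedTraceClass_central_eq_linear_cm L ζ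
        (z₁ := ⟨(quasiSplit (↥(maximalRealSubfield L)) L (IsCMField.complexConj L) 3).toAdelic
          (ratCenter (↥(maximalRealSubfield L)) L (IsCMField.complexConj L) 3 ((StdForm.antidiagonal 3).over L) ζ), _, rfl⟩) rfl
        (borelRefine_charpoly_eq_central_iff (complexConj_mul_complexConj L) ζ)
        (isConjInvariant_borelRefine isConjInvariant_charpoly_adelicVal)
        (isUnipotentInvariantOnBorel_borelRefine isUnipotentInvariantOnBorel_charpoly_adelicVal)
        ν h𝓕 hf μ νG hβ μB μK μT μX μY hwT hcδ hδ θ hθ hd μF νI h𝓕E)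
  obtain ⟨rep, cst, hkey, hlin, hsum⟩ := exists_rep_const_sum_classPolynomial_eval_zero_eq S
    (fun i : (AdeleRing (𝓞 L) L)[X] × Bool => i.2 = true ∧
        ∃ z : Lˣ, (IsCMField.complexConj L) (z : L) * (z : L) = 1 ∧
          i.1 = ((X - C (z : L)) ^ 3).map (algebraMap L (AdeleRing (𝓞 L) L)))
    (fun ζ : ratOne (↥(maximalRealSubfield L)) L (IsCMField.complexConj L) =>
      ((((X - C (((ζ : Lˣ) : L))) ^ 3).map (algebraMap L (AdeleRing (𝓞 L) L))), true))
    (fun _ => True) (fun i hi hpi => exists_ratOne_of_mem_filter_central S i hi hpi)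
    (fun (_ : ratOne (↥(maximalRealSubfield L)) L (IsCMField.complexConj L)) (e : ℝ≥0 × ℝ × ℝ≥0∞) => 0 < e.1 ∧ 0 < e.2.1 ∧ e.2.2 ≠ 0 ∧ e.2.2 ≠ ⊤)
    hrow P hP
  exact ⟨rep, cst, fun i hi => ⟨(hkey i hi).2.1, (hkey i hi).2.2⟩, hlin, hsum⟩

/-! ## §3 (ED. 2) The `closerC` letter of the (L5-ω) skeleton: key and constants packed in ONE product key -/

/-- **THE CENTRAL SOCKET CLOSED, IN THE SHAPE OF THE `closerC` HYPOTHESIS** of ★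
`arthurTrace_eq_orbital_add_central_add_singular_add_hyperbolic_of_closers` (`UnitaryGroupArthurTraceThreeSocketsClosed`) at the
product key type `κc := ratOne L⁺ L c × (ℝ≥0 × ℝ × ℝ≥0∞)` (norm-one unit, `(C₀, C₁, C₂)`): for `S`, `P`, `hP` as in §2 there is
`zrep : _ → κc` with `Σ_{S.filter central} P_i(0) = Σ_{S.filter central} Bc (zrep i)`, `Bc` = the constant term of ★
`truncatedTraceClass_central_eq_linear_cm` [Rogawski Prop. 7.3.2 (a)–(e)] read at `ζ := (zrep i).1`, `(C₀, C₁, C₂) := (zrep i).2` —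
§2 with the two choice functions paired. Dock: `closerC := exists_keyrep_sum_filter_central_classPolynomial_eval_zero_cm L ν h𝓕 hf μ νG
hβ μB μK μT μX μY hwT hcδ hδ θ hθ hd μF νI h𝓕E`. [cite: Rogawski1990, Prop. 7.3.2 (pp. 96–97)]
[cite: Arthur1981TraceFormulaInvariantForm, Prop. 2.3] -/
theorem exists_keyrep_sum_filter_central_classPolynomial_eval_zero_cm (L : Type) [Field L] [NumberField L] [IsCMField L]
    [MeasurableSpace (adelicUnipotent (↥(maximalRealSubfield L)) L (IsCMField.complexConj L) 3)]
    [BorelSpace (adelicUnipotent (↥(maximalRealSubfield L)) L (IsCMField.complexConj L) 3)]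
    [MeasurableSpace (quasiSplit (↥(maximalRealSubfield L)) L (IsCMField.complexConj L) 3).Adelic]
    [BorelSpace (quasiSplit (↥(maximalRealSubfield L)) L (IsCMField.complexConj L) 3).Adelic]
    [MeasurableSpace (AdeleRing (𝓞 L) L)] [BorelSpace (AdeleRing (𝓞 L) L)]
    [MeasurableSpace (GaloisRepresentations.ideleGroup L)] [BorelSpace (GaloisRepresentations.ideleGroup L)]
    [MeasurableSpace (AdeleRing (𝓞 (↥(maximalRealSubfield L))) (↥(maximalRealSubfield L)))ˣ]
    [BorelSpace (AdeleRing (𝓞 (↥(maximalRealSubfield L))) (↥(maximalRealSubfield L)))ˣ]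
    (ν : Measure (adelicUnipotent (↥(maximalRealSubfield L)) L (IsCMField.complexConj L) 3)) [ν.IsHaarMeasure]
    {𝓕 : Set (adelicUnipotent (↥(maximalRealSubfield L)) L (IsCMField.complexConj L) 3)} (h𝓕 : IsFundamentalDomain (rationalUnipotent (↥(maximalRealSubfield L)) L (IsCMField.complexConj L) 3) 𝓕 ν)
    {f : (quasiSplit (↥(maximalRealSubfield L)) L (IsCMField.complexConj L) 3).Adelic → ℂ} (hf : IsQuasiSplitTest (↥(maximalRealSubfield L)) L (IsCMField.complexConj L) 3 f)
    (μ : Measure (quasiSplit (↥(maximalRealSubfield L)) L (IsCMField.complexConj L) 3).automorphicQuotient) [(quasiSplit (↥(maximalRealSubfield L)) L (IsCMField.complexConj L) 3).IsAutomorphicMeasure μ]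
    (νG : Measure (quasiSplit (↥(maximalRealSubfield L)) L (IsCMField.complexConj L) 3).Adelic) [νG.IsHaarMeasure]
    {β : (quasiSplit (↥(maximalRealSubfield L)) L (IsCMField.complexConj L) 3).Adelic → ℝ≥0∞}
    (hβ : IsCoveringWeight ((arithmeticBorel (↥(maximalRealSubfield L)) L (IsCMField.complexConj L) 3).map (quasiSplit (↥(maximalRealSubfield L)) L (IsCMField.complexConj L) 3).arithmeticSubgroup.subtype) β)
    (μB : Measure (borelAdelic (↥(maximalRealSubfield L)) L (IsCMField.complexConj L) 3)) [μB.IsHaarMeasure]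
    (μK : Measure ((standardMaximalCompactGL 3 L).comap
      (adelicVal (↥(maximalRealSubfield L)) L (IsCMField.complexConj L) 3 ((StdForm.antidiagonal 3).over L)) : Subgroup (quasiSplit (↥(maximalRealSubfield L)) L (IsCMField.complexConj L) 3).Adelic))
    [μK.IsHaarMeasure]
    (μT : Measure (torusInBorel (↥(maximalRealSubfield L)) L (IsCMField.complexConj L) 3)) [μT.IsHaarMeasure]
    (μX : Measure (AdeleRing (𝓞 L) L)) [μX.IsAddHaarMeasure]
    (μY : Measure (traceZeroAdele (↥(maximalRealSubfield L)) L (IsCMField.complexConj L))) [μY.IsAddHaarMeasure]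
    {wT : torusInBorel (↥(maximalRealSubfield L)) L (IsCMField.complexConj L) 3 → ℝ≥0∞}
    (hwT : IsCoveringWeight ((((quasiSplit (↥(maximalRealSubfield L)) L (IsCMField.complexConj L) 3).arithmeticSubgroup).subgroupOf (borelAdelic (↥(maximalRealSubfield L)) L (IsCMField.complexConj L) 3)).subgroupOf
      (torusInBorel (↥(maximalRealSubfield L)) L (IsCMField.complexConj L) 3)) wT)
    {δ : L} (hcδ : (IsCMField.complexConj L) δ = -δ) (hδ : δ ≠ 0) (θ : 𝓞 (↥(maximalRealSubfield L))) (hθ : θ ≠ 0)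
    (hd : δ * δ = algebraMap (↥(maximalRealSubfield L)) L (θ : (↥(maximalRealSubfield L))))
    (μF : Measure (AdeleRing (𝓞 (↥(maximalRealSubfield L))) (↥(maximalRealSubfield L)))ˣ) [IsHaarMeasure μF]
    (νI : Measure (GaloisRepresentations.ideleGroup L)) [νI.IsHaarMeasure]
    {𝓕E : Set (GaloisRepresentations.ideleGroup L)} (h𝓕E : IsIdeleClassDomain L 𝓕E)
    (S : Finset ((AdeleRing (𝓞 L) L)[X] × Bool)) (P : (AdeleRing (𝓞 L) L)[X] × Bool → ℂ[X])
    (hP : ∀ i ∈ S, ∃ T₀ : ℝ≥0, ∀ T : ℝ≥0, T₀ < T →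
      truncatedTraceClass μ ν 𝓕 T
          (fun γ : (quasiSplit (↥(maximalRealSubfield L)) L (IsCMField.complexConj L) 3).arithmeticSubgroup =>
            (((adelicVal (↥(maximalRealSubfield L)) L (IsCMField.complexConj L) 3 _
                (γ : (quasiSplit (↥(maximalRealSubfield L)) L (IsCMField.complexConj L) 3).Adelic) :
                GL (Fin 3) (AdeleRing (𝓞 L) L)) : Matrix (Fin 3) (Fin 3) (AdeleRing (𝓞 L) L)).charpoly,
              decide (∃ δ : (quasiSplit (↥(maximalRealSubfield L)) L (IsCMField.complexConj L) 3).arithmeticSubgroup,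
                δ * γ * δ⁻¹ ∈ arithmeticBorel (↥(maximalRealSubfield L)) L (IsCMField.complexConj L) 3)))
          i f = (P i).eval ((Real.log (T : ℝ) : ℝ) : ℂ)) :
    haveI := t2Space_adeleRing_of_numberField L
    haveI := locallyCompactSpace_adeleRing' L
    haveI := secondCountableTopology_adeleRing L
    haveI : T2Space (quasiSplit (↥(maximalRealSubfield L)) L (IsCMField.complexConj L) 3).Adelic :=
      inferInstanceAs (T2Space (adelic (↥(maximalRealSubfield L)) L (IsCMField.complexConj L) 3 ((StdForm.antidiagonal 3).over L)))
    haveI : LocallyCompactSpace (quasiSplit (↥(maximalRealSubfield L)) L (IsCMField.complexConj L) 3).Adelic :=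
      inferInstanceAs (LocallyCompactSpace (adelic (↥(maximalRealSubfield L)) L (IsCMField.complexConj L) 3 ((StdForm.antidiagonal 3).over L)))
    haveI : SecondCountableTopology (quasiSplit (↥(maximalRealSubfield L)) L (IsCMField.complexConj L) 3).Adelic :=
      inferInstanceAs (SecondCountableTopology (adelic (↥(maximalRealSubfield L)) L (IsCMField.complexConj L) 3 ((StdForm.antidiagonal 3).over L)))
    haveI : DiscreteTopology (quasiSplit (↥(maximalRealSubfield L)) L (IsCMField.complexConj L) 3).quotientSubgroup := by
      rw [quotientSubgroup_quasiSplit]; exact isDiscreteRational_quasiSplit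
    letI := AdelicGroupData.measurableSpaceQuotientForm (quasiSplit (↥(maximalRealSubfield L)) L (IsCMField.complexConj L) 3)
    haveI := AdelicGroupData.borelSpaceQuotientForm (quasiSplit (↥(maximalRealSubfield L)) L (IsCMField.complexConj L) 3)
    haveI := AdelicGroupData.smulInvariantMeasureQuotientForm (quasiSplit (↥(maximalRealSubfield L)) L (IsCMField.complexConj L) 3) μ
    haveI := AdelicGroupData.isFiniteMeasureOnCompactsQuotientForm (quasiSplit (↥(maximalRealSubfield L)) L (IsCMField.complexConj L) 3) μ
    ∃ zrep : (AdeleRing (𝓞 L) L)[X] × Bool → ratOne (↥(maximalRealSubfield L)) L (IsCMField.complexConj L) × (ℝ≥0 × ℝ × ℝ≥0∞),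
      ∑ i ∈ S.filter (fun i : (AdeleRing (𝓞 L) L)[X] × Bool => i.2 = true ∧
        ∃ z : Lˣ, (IsCMField.complexConj L) (z : L) * (z : L) = 1 ∧
          i.1 = ((X - C (z : L)) ^ 3).map (algebraMap L (AdeleRing (𝓞 L) L))), (P i).eval 0 =
        ∑ i ∈ S.filter (fun i : (AdeleRing (𝓞 L) L)[X] × Bool => i.2 = true ∧
        ∃ z : Lˣ, (IsCMField.complexConj L) (z : L) * (z : L) = 1 ∧
          i.1 = ((X - C (z : L)) ^ 3).map (algebraMap L (AdeleRing (𝓞 L) L))),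
          ((μ.real Set.univ : ℝ) • f ((quasiSplit (↥(maximalRealSubfield L)) L (IsCMField.complexConj L) 3).toAdelic (ratCenter (↥(maximalRealSubfield L)) L (IsCMField.complexConj L) 3 ((StdForm.antidiagonal 3).over L) (zrep i).1)) +
            ((unfoldingConstant (quasiSplit (↥(maximalRealSubfield L)) L (IsCMField.complexConj L) 3).quotientSubgroup
            (count : Measure (quasiSplit (↥(maximalRealSubfield L)) L (IsCMField.complexConj L) 3).quotientSubgroup) μ νG : ℝ) : ℂ) * (((((zrep i).2.1 : ℝ) : ℂ) * ((heisHaar (complexConj_mul_complexConj L) μX μY).real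
              (heisHomeomorph (complexConj_mul_complexConj L) '' (adeleFundamentalDomain L ×ˢ traceZeroFundamentalDomain (↥(maximalRealSubfield L)) L (IsCMField.complexConj L))) : ℂ) *
            ∫ y in ↑(GaloisRepresentations.principalIdeles (↥(maximalRealSubfield L)) ⊔ normIdeles (↥(maximalRealSubfield L)) (θ : (↥(maximalRealSubfield L)))),
              (((IdeleClassGroup.ideleNorm (↥(maximalRealSubfield L)) y ^ 2)⁻¹ : ℝ≥0) : ℝ) •
                ∫ k, f ((k : (quasiSplit (↥(maximalRealSubfield L)) L (IsCMField.complexConj L) 3).Adelic)⁻¹ * (((quasiSplit (↥(maximalRealSubfield L)) L (IsCMField.complexConj L) 3).toAdelic (ratCenter (↥(maximalRealSubfield L)) L (IsCMField.complexConj L) 3 ((StdForm.antidiagonal 3).over L) (zrep i).1)) *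
                  ((heisChart (complexConj_mul_complexConj L) ((0 : AdeleRing (𝓞 L) L),
                      traceZeroLine (↥(maximalRealSubfield L)) L (IsCMField.complexConj L) hcδ hδ (((y⁻¹ : (AdeleRing (𝓞 (↥(maximalRealSubfield L))) (↥(maximalRealSubfield L)))ˣ)) : AdeleRing (𝓞 (↥(maximalRealSubfield L))) (↥(maximalRealSubfield L)))) :
                    adelicUnipotent (↥(maximalRealSubfield L)) L (IsCMField.complexConj L) 3) : (quasiSplit (↥(maximalRealSubfield L)) L (IsCMField.complexConj L) 3).Adelic)) * (k : (quasiSplit (↥(maximalRealSubfield L)) L (IsCMField.complexConj L) 3).Adelic)) ∂μK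
              ∂μF) +
          ((((zrep i).2.2.1 : ℝ) : ℂ) * ((μX.real (adeleFundamentalDomain L) : ℂ) * (((zrep i).2.2.2).toReal : ℂ)) *
            (((∫ x in {x | 1 ≤ (IdeleClassGroup.ideleNorm L x : ℝ)} ∩ 𝓕E,
                  ideleSum L (fun x => ∫ y' : traceZeroAdele (↥(maximalRealSubfield L)) L (IsCMField.complexConj L),
        (∫ k, f ((k : (quasiSplit (↥(maximalRealSubfield L)) L (IsCMField.complexConj L) 3).Adelic)⁻¹ * (((quasiSplit (↥(maximalRealSubfield L)) L (IsCMField.complexConj L) 3).toAdelic (ratCenter (↥(maximalRealSubfield L)) L (IsCMField.complexConj L) 3 ((StdForm.antidiagonal 3).over L) (zrep i).1)) *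
          (((heisChart (complexConj_mul_complexConj L) (x, y')) : adelicUnipotent (↥(maximalRealSubfield L)) L (IsCMField.complexConj L) 3) :
              (quasiSplit (↥(maximalRealSubfield L)) L (IsCMField.complexConj L) 3).Adelic)) * (k : (quasiSplit (↥(maximalRealSubfield L)) L (IsCMField.complexConj L) 3).Adelic)) ∂μK) ∂μY) x * ((IdeleClassGroup.ideleNorm L x : ℝ) : ℂ) ∂νI) +
                ((μX (adeleFundamentalDomain L)).toReal⁻¹ : ℂ) *
                  (∫ x in {x | 1 ≤ (IdeleClassGroup.ideleNorm L x : ℝ)} ∩ 𝓕E,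
                    ideleSum L (adeleFourier L μX (fun x => ∫ y' : traceZeroAdele (↥(maximalRealSubfield L)) L (IsCMField.complexConj L),
        (∫ k, f ((k : (quasiSplit (↥(maximalRealSubfield L)) L (IsCMField.complexConj L) 3).Adelic)⁻¹ * (((quasiSplit (↥(maximalRealSubfield L)) L (IsCMField.complexConj L) 3).toAdelic (ratCenter (↥(maximalRealSubfield L)) L (IsCMField.complexConj L) 3 ((StdForm.antidiagonal 3).over L) (zrep i).1)) *
          (((heisChart (complexConj_mul_complexConj L) (x, y')) : adelicUnipotent (↥(maximalRealSubfield L)) L (IsCMField.complexConj L) 3) :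
              (quasiSplit (↥(maximalRealSubfield L)) L (IsCMField.complexConj L) 3).Adelic)) * (k : (quasiSplit (↥(maximalRealSubfield L)) L (IsCMField.complexConj L) 3).Adelic)) ∂μK) ∂μY)) x ∂νI) -
                ((idelicCovolume L νI).toReal : ℂ) * (fun x => ∫ y' : traceZeroAdele (↥(maximalRealSubfield L)) L (IsCMField.complexConj L),
        (∫ k, f ((k : (quasiSplit (↥(maximalRealSubfield L)) L (IsCMField.complexConj L) 3).Adelic)⁻¹ * (((quasiSplit (↥(maximalRealSubfield L)) L (IsCMField.complexConj L) 3).toAdelic (ratCenter (↥(maximalRealSubfield L)) L (IsCMField.complexConj L) 3 ((StdForm.antidiagonal 3).over L) (zrep i).1)) *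
          (((heisChart (complexConj_mul_complexConj L) (x, y')) : adelicUnipotent (↥(maximalRealSubfield L)) L (IsCMField.complexConj L) 3) :
              (quasiSplit (↥(maximalRealSubfield L)) L (IsCMField.complexConj L) 3).Adelic)) * (k : (quasiSplit (↥(maximalRealSubfield L)) L (IsCMField.complexConj L) 3).Adelic)) ∂μK) ∂μY) 0) -
              (((idelicCovolume L νI).toReal : ℂ) * (((μX (adeleFundamentalDomain L)).toReal⁻¹ : ℂ) *
                  adeleFourier L μX (fun x => ∫ y' : traceZeroAdele (↥(maximalRealSubfield L)) L (IsCMField.complexConj L),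
        (∫ k, f ((k : (quasiSplit (↥(maximalRealSubfield L)) L (IsCMField.complexConj L) 3).Adelic)⁻¹ * (((quasiSplit (↥(maximalRealSubfield L)) L (IsCMField.complexConj L) 3).toAdelic (ratCenter (↥(maximalRealSubfield L)) L (IsCMField.complexConj L) 3 ((StdForm.antidiagonal 3).over L) (zrep i).1)) *
          (((heisChart (complexConj_mul_complexConj L) (x, y')) : adelicUnipotent (↥(maximalRealSubfield L)) L (IsCMField.complexConj L) 3) :
              (quasiSplit (↥(maximalRealSubfield L)) L (IsCMField.complexConj L) 3).Adelic)) * (k : (quasiSplit (↥(maximalRealSubfield L)) L (IsCMField.complexConj L) 3).Adelic)) ∂μK) ∂μY) 0)) *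
                ((Real.log (borelHeight (1 : (quasiSplit (↥(maximalRealSubfield L)) L (IsCMField.complexConj L) 3).Adelic) : ℝ) : ℝ) : ℂ))))) := by
  have h := exists_rep_sum_filter_central_classPolynomial_eval_zero_cm L ν h𝓕 hf μ νG hβ μB μK μT μX μY hwT hcδ hδ θ hθ hd
    μF νI h𝓕E S P hP
  cases h with
  | intro zrep h1 =>
    cases h1 with
    | intro cst h2 => exact ⟨fun i => (zrep i, cst i), h2.2.2⟩

end CM

end UnitaryGroup

end Literature.NumberTheory.Automorphic
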